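import Summits.BirchSwinnertonDyer.BirchSwinnertonDyer.Theorems.GoldfeldAllTwistsTwoConverseTwinGenusDescentMinimal
import Summits.BirchSwinnertonDyer.BirchSwinnertonDyer.Theorems.GoldfeldAllTwistsTwoConverseTwinAdditivePrimeTwistDescent
import Literature.NumberTheory.EllipticCurves.Zywina2025RankTwo
import HarnessLib

set_option linter.dupNamespace false -- `…BirchSwinnertonDyer.BirchSwinnertonDyer…` is the cell's namespace (D-0017)
set_option autoImplicit false

/-!
# LINE B49 — the FIXED partner curves, IV: `49a1^{(2)}` (`N = 3136`) has rank ZERO and `Ш[2] = 0`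
# (complete `2`-isogeny descent `S(42,448) = {1,7}`, `S(−84,−28) = {1,−7}`; family F3)

Cell `bsd-goldfeld`, seat `bsd-goldfeld-s1p-c301` (prover, gen 6); TARGET v5.2 §2 c301 (f), planner g14
(xvi); support for item `stmt-BirchSwinnertonDyer-19140` (twin″; joint with 20044). HONEST FRAMING:
theorems about one explicit curve; the last two take bsd.S31 and Modularity as NAMED binders; BSD is not
proved by any of this; not in the Theses cone. The third fixed partner of the genus mechanism (memo
`B49-GENUS.md` §1, family F3: `d = −2q`, `q ≡ 3 (4)`, `L(X₀(49)/K, χ, s) = L(49a1^{(2)}, s)·L(49a1^{(−q)}, s)`)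
is the RANK-ZERO curve `49a1^{(2)}` (`[0,0,0,−140,−784]`, two-torsion model `E₂ = [0,42,0,448,0] =
(1/2,4,0,0) • cm7^{(2)}`, file III). §1 reusable LOCAL LEMMAS: real obstruction in the DEFINITE case
(`d < 0`, `a² < 4dd'`, any sign of `a`), odd `p` with `p ∣ a`, `p ∥ d'`, `d` non-residue, and the
`2`-adic residue test on both `ℤ₂`-charts (`decide`, mod `2⁴/2⁶/2⁸`); §2 `S(42,448) ⊆ {1,7}`,
`S(−84,−28) ⊆ {1,−7}`; §3 the count `#S·#S' = 2^{rank+2}·#Ш(E')[φ̂]·#Ш(E)[φ]` ⇒ **rank `0`, `Ш[2] = 0`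
(UNCONDITIONAL)** for `E₂` and `cm7^{(2)}`, and the bsd.S31 hook ⇒ `r_an = 0`, `Ш` finite of odd order,
leading-term formula. References: [SilvermanAEC2009] X.4.2(a), X.4.9, X.4.10; [SilvermanTate2015] §3.6;
[CremonaAlgorithms1997] Table 1 (3136); [CreutzMiller2012]; [Miller2011LMS].
-/

noncomputable section

open scoped Classical

open WeierstrassCurve Literature.NumberTheory.EllipticCurves Literature.NumberTheory.EllipticCurves.ModularForms
open Literature.NumberTheory.EllipticCurves.Zywina2025 (exists_padicInt_of_isSoluble)

namespace Summit.BirchSwinnertonDyer.BirchSwinnertonDyer.Theorems.GoldfeldGoodTwists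

/-! ## §1 Local lemmas -/

section Local

/-- **Real obstruction, definite case.** If `d < 0` and `a² < 4 d d'` then
`w² = d u⁴ + a u²z² + d' z⁴` has no non-trivial real point: `4d·q(u,z) = (2d u² + a z²)² + (4dd' − a²) z⁴`
is `> 0` off the origin while `4d w² ≤ 0`. (Covers `a > 0`, unlike the tree's
`not_isSoluble_real_twoIsogenyQuartic_of_neg`.) [cite: SilvermanAEC2009, Prop. X.4.9 and Example X.4.10] -/
theorem not_isSoluble_real_twoIsogenyQuartic_of_neg_of_sq_lt {a d d' : ℤ} (hd : d < 0)
    (hdd' : a ^ 2 < 4 * (d * d')) :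
    ¬ ((twoIsogenyQuartic a d d').map (Int.castRingHom ℝ)).IsSoluble := by
  rintro ⟨u, z, w, h0, h⟩
  rw [eval_map_twoIsogenyQuartic] at h
  simp only [eq_intCast] at h
  have hd₁ : (d : ℝ) < 0 := by exact_mod_cast hd
  have hdd : ((a : ℝ)) ^ 2 < 4 * ((d : ℝ) * d') := by exact_mod_cast hdd'
  have hw : 0 ≤ w ^ 2 := sq_nonneg w
  -- `4 d w² = (2 d u² + a z²)² + (4 d d' − a²) z⁴`
  have key : 4 * (d : ℝ) * w ^ 2 = (2 * d * u ^ 2 + a * z ^ 2) ^ 2 + (4 * (d * d') - a ^ 2) * z ^ 4 := by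
    rw [h]; ring
  have hneg : 4 * (d : ℝ) * w ^ 2 ≤ 0 :=
    mul_nonpos_of_nonpos_of_nonneg (by linarith) hw
  have hz4 : 0 ≤ z ^ 4 := by positivity
  have hsq : 0 ≤ (2 * (d : ℝ) * u ^ 2 + a * z ^ 2) ^ 2 := sq_nonneg _
  rcases h0 with hu | hz
  · by_cases hz0 : z = 0
    · subst hz0
      have : (2 * (d : ℝ) * u ^ 2) ^ 2 ≤ 0 := by nlinarith
      have h2 : 2 * (d : ℝ) * u ^ 2 = 0 := by nlinarith [sq_nonneg (2 * (d : ℝ) * u ^ 2)]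
      rcases mul_eq_zero.mp h2 with h3 | h3
      · rcases mul_eq_zero.mp h3 with h4 | h4
        · norm_num at h4
        · exact absurd h4 hd₁.ne
      · exact hu (pow_eq_zero_iff two_ne_zero |>.mp h3)
    · have hz4' : 0 < z ^ 4 := by positivity
      nlinarith [mul_pos (sub_pos.mpr hdd) hz4']
  · have hz4' : 0 < z ^ 4 := by positivity
    nlinarith [mul_pos (sub_pos.mpr hdd) hz4']

/-- In `ℤ_p`: `x mod p = 0 ↔ p ∣ x`. [folklore] -/
private theorem toZMod_eq_zero_iff_dvd'' {p : ℕ} [Fact p.Prime] (x : ℤ_[p]) :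
    PadicInt.toZMod x = 0 ↔ (p : ℤ_[p]) ∣ x := by
  rw [← RingHom.mem_ker, PadicInt.ker_toZMod, PadicInt.maximalIdeal_eq_span_p,
    Ideal.mem_span_singleton]

/-- **Local lemma at an odd prime `p` with `p ∣ a`, `p ∥ d'`, `d` a non-residue.** If `a = p c`,
`d' = p e'` with `p ∤ e'`, and `d` is not a square mod `p`, then `w² = d u⁴ + a u²z² + d' z⁴` has no
non-trivial `ℚ_p`-point: in the chart `u = 1`, `s² ≡ d (mod p)`; in the chart `z = 1`,
`s² = p e' + p c t² + d t⁴` gives `s² ≡ d t⁴` (so `d ≡ □`) if `p ∤ t`, and `p ∣ s`, `p² ∣ p e'` if `p ∣ t`.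
Used at `p = 7` for the classes `−1, −2, 7, 14` of `S(−84, −28)`.
[cite: SilvermanAEC2009, Prop. X.4.9 and Example X.4.10] -/
theorem not_isSoluble_padic_of_nonresidue_of_prime_dvd {p : ℕ} [Fact p.Prime] {a d d' c e' : ℤ}
    (ha : a = p * c) (hd' : d' = p * e') (he' : ¬ (p : ℤ) ∣ e') (hd : ¬ IsSquare ((d : ℤ) : ZMod p)) :
    ¬ ((twoIsogenyQuartic a d d').map (Int.castRingHom ℚ_[p])).IsSoluble := by
  have hpp : Prime (p : ℤ_[p]) := PadicInt.prime_p
  intro h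
  obtain ⟨f, f', hff, t, s, hs⟩ := exists_padicInt_of_isSoluble h
  rcases hff with ⟨hf, hf'⟩ | ⟨hf, hf'⟩
  · -- chart `u = 1`: `s² = d + p c t² + p e' t⁴ ≡ d (mod p)`
    rw [hf, hf', ha, hd'] at hs
    push_cast at hs
    have h0 := congrArg PadicInt.toZMod hs
    simp only [map_pow, map_add, map_mul, map_intCast, map_natCast, ZMod.natCast_self, zero_mul,
      add_zero] at h0
    exact hd ⟨PadicInt.toZMod s, by rw [← pow_two, h0]⟩
  · -- chart `z = 1`: `s² = p e' + p c t² + d t⁴`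
    rw [hf, hf', ha, hd'] at hs
    push_cast at hs
    by_cases ht : (p : ℤ_[p]) ∣ t
    · obtain ⟨t₁, rfl⟩ := ht
      have hs2 : (p : ℤ_[p]) ∣ s ^ 2 :=
        ⟨e' + c * (p : ℤ_[p]) ^ 2 * t₁ ^ 2 + d * (p : ℤ_[p]) ^ 3 * t₁ ^ 4, by rw [hs]; ring⟩
      obtain ⟨s₁, rfl⟩ := hpp.dvd_of_dvd_pow hs2
      -- `p² s₁² = p (e' + p(…))` ⇒ `p ∣ e'`
      have h1 : (e' : ℤ_[p]) = (p : ℤ_[p]) * (s₁ ^ 2 - c * (p : ℤ_[p]) * t₁ ^ 2 - d * (p : ℤ_[p]) ^ 2 * t₁ ^ 4) :=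
        mul_left_cancel₀ hpp.ne_zero (by linear_combination -hs)
      have h2 : PadicInt.toZMod (e' : ℤ_[p]) = 0 := by
        rw [toZMod_eq_zero_iff_dvd'']; exact ⟨_, h1⟩
      rw [map_intCast, ZMod.intCast_zmod_eq_zero_iff_dvd] at h2
      exact he' h2
    · have h0 := congrArg PadicInt.toZMod hs
      simp only [map_pow, map_add, map_mul, map_intCast, map_natCast, ZMod.natCast_self, zero_mul,
        zero_add] at h0
      have hT : PadicInt.toZMod t ≠ 0 := by rwa [Ne, toZMod_eq_zero_iff_dvd'']
      refine hd ⟨PadicInt.toZMod s / PadicInt.toZMod t ^ 2, ?_⟩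
      have hT4 : PadicInt.toZMod t ^ 4 ≠ 0 := pow_ne_zero 4 hT
      rw [show PadicInt.toZMod s / PadicInt.toZMod t ^ 2 * (PadicInt.toZMod s / PadicInt.toZMod t ^ 2) =
          PadicInt.toZMod s ^ 2 / PadicInt.toZMod t ^ 4 by ring, h0, mul_div_assoc, div_self hT4, mul_one]

/-- **`2`-adic obstruction by residues.** If, for some `k, k'`, neither chart of
`w² = d u⁴ + a u²z² + d' z⁴` has a solution modulo `2ᵏ` resp. `2ᵏ'` (`S² ≠ d + aT² + d'T⁴ (mod 2ᵏ)`,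
`S² ≠ d' + aT² + dT⁴ (mod 2ᵏ')` for all residues), then it has no non-trivial `ℚ₂`-point (a
`ℚ₂`-point gives a `ℤ₂`-point in one of the two charts, `exists_padicInt_of_isSoluble`).
[cite: SilvermanAEC2009, Prop. X.4.9 and Example X.4.10] -/
theorem not_isSoluble_two_of_zmodPow {a d d' : ℤ} (k k' : ℕ)
    (hA : ∀ T S : ZMod (2 ^ k), S ^ 2 ≠ (d : ZMod (2 ^ k)) + a * T ^ 2 + d' * T ^ 4)
    (hB : ∀ T S : ZMod (2 ^ k'), S ^ 2 ≠ (d' : ZMod (2 ^ k')) + a * T ^ 2 + d * T ^ 4) :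
    ¬ ((twoIsogenyQuartic a d d').map (Int.castRingHom ℚ_[2])).IsSoluble := by
  haveI : Fact (Nat.Prime 2) := ⟨Nat.prime_two⟩
  intro h
  obtain ⟨f, f', hff, t, s, hs⟩ := exists_padicInt_of_isSoluble h
  rcases hff with ⟨rfl, rfl⟩ | ⟨rfl, rfl⟩
  · have h2 := congrArg (PadicInt.toZModPow k : ℤ_[2] →+* ZMod (2 ^ k)) hs
    simp only [map_pow, map_add, map_mul, map_intCast] at h2
    exact hA _ _ h2
  · have h2 := congrArg (PadicInt.toZModPow k' : ℤ_[2] →+* ZMod (2 ^ k')) hs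
    simp only [map_pow, map_add, map_mul, map_intCast] at h2
    exact hB _ _ h2

/-- Residues modulo `16` / `256`: the class `2` of `S(42, 448)` (`w² = 2u⁴ + 42u²z² + 224z⁴`) has no
`ℤ₂`-point in either chart (chart `z`-adic needs `2⁸`: `t ≡ 4 (mod 8)` gives `2⁷ ∥ s²`). [folklore] -/
theorem zmod_key_two_448 :
    (∀ T S : ZMod (2 ^ 4), S ^ 2 ≠ ((2 : ℤ) : ZMod (2 ^ 4)) + ((42 : ℤ) : ZMod (2 ^ 4)) * T ^ 2 + ((224 : ℤ) : ZMod (2 ^ 4)) * T ^ 4) ∧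
    (∀ T S : ZMod (2 ^ 8), S ^ 2 ≠ ((224 : ℤ) : ZMod (2 ^ 8)) + ((42 : ℤ) : ZMod (2 ^ 8)) * T ^ 2 + ((2 : ℤ) : ZMod (2 ^ 8)) * T ^ 4) := by
  constructor
  · decide
  · decide +kernel

/-- Residues modulo `16` / `256`: the class `14` of `S(42, 448)` (`w² = 14u⁴ + 42u²z² + 32z⁴`).
[folklore] -/
theorem zmod_key_fourteen_448 :
    (∀ T S : ZMod (2 ^ 4), S ^ 2 ≠ ((14 : ℤ) : ZMod (2 ^ 4)) + ((42 : ℤ) : ZMod (2 ^ 4)) * T ^ 2 + ((32 : ℤ) : ZMod (2 ^ 4)) * T ^ 4) ∧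
    (∀ T S : ZMod (2 ^ 8), S ^ 2 ≠ ((32 : ℤ) : ZMod (2 ^ 8)) + ((42 : ℤ) : ZMod (2 ^ 8)) * T ^ 2 + ((14 : ℤ) : ZMod (2 ^ 8)) * T ^ 4) := by
  constructor
  · decide
  · decide +kernel

/-- Residues modulo `64`: the class `2` of `S(−84, −28)` (`w² = 2u⁴ − 84u²z² − 14z⁴`; for units
`t`, `2⁵ ∥ s²`). [folklore] -/
theorem zmod_key_two_neg28 :
    (∀ T S : ZMod (2 ^ 6), S ^ 2 ≠ ((2 : ℤ) : ZMod (2 ^ 6)) + ((-84 : ℤ) : ZMod (2 ^ 6)) * T ^ 2 + ((-14 : ℤ) : ZMod (2 ^ 6)) * T ^ 4) ∧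
    (∀ T S : ZMod (2 ^ 6), S ^ 2 ≠ ((-14 : ℤ) : ZMod (2 ^ 6)) + ((-84 : ℤ) : ZMod (2 ^ 6)) * T ^ 2 + ((2 : ℤ) : ZMod (2 ^ 6)) * T ^ 4) := by
  constructor <;> decide +kernel

end Local
/-! ## §2 The two Selmer sets of `E₂ : y² = x³ + 42x² + 448x` (`= (1/2, 4, 0, 0) • cm7^{(2)}`) -/

section Selmer

/-- Squarefree divisors of `448 = 2⁶·7`: `|d| ∈ {1, 2, 7, 14}`. [folklore] -/
theorem natAbs_eq_of_squarefree_of_dvd_448 {d : ℤ} (hsq : Squarefree d) (hd : d ∣ 448) :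
    d.natAbs = 1 ∨ d.natAbs = 2 ∨ d.natAbs = 7 ∨ d.natAbs = 14 := by
  have h1 : d.natAbs ∣ 448 := by exact_mod_cast Int.natAbs_dvd_natAbs.mpr hd
  have h2 : Squarefree d.natAbs := Int.squarefree_natAbs.mpr hsq
  have hmem : d.natAbs ∈ (Nat.divisors 448).filter Squarefree :=
    Finset.mem_filter.mpr ⟨Nat.mem_divisors.mpr ⟨h1, by norm_num⟩, h2⟩
  have hset : (Nat.divisors 448).filter Squarefree = {1, 2, 7, 14} := by decide +kernel
  rw [hset] at hmem
  simpa using hmem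

/-- Squarefree divisors of `−28 = −2²·7`: `|d| ∈ {1, 2, 7, 14}`. [folklore] -/
theorem natAbs_eq_of_squarefree_of_dvd_neg28 {d : ℤ} (hsq : Squarefree d) (hd : d ∣ -28) :
    d.natAbs = 1 ∨ d.natAbs = 2 ∨ d.natAbs = 7 ∨ d.natAbs = 14 := by
  have h1 : d.natAbs ∣ 28 := by
    have := Int.natAbs_dvd_natAbs.mpr hd; simpa using this
  have h2 : Squarefree d.natAbs := Int.squarefree_natAbs.mpr hsq
  have hmem : d.natAbs ∈ (Nat.divisors 28).filter Squarefree :=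
    Finset.mem_filter.mpr ⟨Nat.mem_divisors.mpr ⟨h1, by norm_num⟩, h2⟩
  have hset : (Nat.divisors 28).filter Squarefree = {1, 2, 7, 14} := by decide +kernel
  rw [hset] at hmem
  simpa using hmem

/-- **`S(42, 448) ⊆ {1, 7}`** (the descent-on-divisors-of-`b` Selmer set of `E₂`): negative classes
die over `ℝ` (`42² = 1764 < 1792 = 4·448`), the classes `2` and `14` die `2`-adically (residues mod
`2⁴`/`2⁸`); `1` and `7 ≡ 448` are the images of `O` and `T`. [cite: SilvermanAEC2009, Prop. X.4.9] -/
theorem mem_twoIsogenySelmerGroup_448 {d : ℤ} (h : d ∈ twoIsogenySelmerGroup 42 448) :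
    d = 1 ∨ d = 7 := by
  haveI : Fact (Nat.Prime 2) := ⟨Nat.prime_two⟩
  obtain ⟨hsq, hdvd, hloc⟩ := (mem_twoIsogenySelmerGroup_iff (by norm_num : (448 : ℤ) ≠ 0)).mp h
  have habs := natAbs_eq_of_squarefree_of_dvd_448 hsq hdvd
  rcases Int.natAbs_eq d with hpos | hneg
  · rcases habs with h1 | h2 | h7 | h14
    · left; omega
    · exfalso
      have hd2 : d = 2 := by omega
      subst hd2
      have h2' := hloc.2 2
      rw [show (448 : ℤ) / 2 = 224 by norm_num] at h2'
      exact not_isSoluble_two_of_zmodPow 4 8 zmod_key_two_448.1 zmod_key_two_448.2 h2'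
    · right; omega
    · exfalso
      have hd14 : d = 14 := by omega
      subst hd14
      have h2' := hloc.2 2
      rw [show (448 : ℤ) / 14 = 32 by norm_num] at h2'
      exact not_isSoluble_two_of_zmodPow 4 8 zmod_key_fourteen_448.1 zmod_key_fourteen_448.2 h2'
  · exfalso
    have hd0 : d < 0 := by rcases habs with h | h | h | h <;> omega
    refine not_isSoluble_real_twoIsogenyQuartic_of_neg_of_sq_lt hd0 ?_ hloc.1
    rw [Int.mul_ediv_cancel' hdvd]; norm_num

/-- `−1, −2, −4` are non-residues modulo `7`. [folklore] -/
theorem not_isSquare_zmod_seven :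
    ¬ IsSquare ((-1 : ℤ) : ZMod 7) ∧ ¬ IsSquare ((-2 : ℤ) : ZMod 7) ∧ ¬ IsSquare ((-4 : ℤ) : ZMod 7) := by decide

/-- **`S(−84, −28) ⊆ {1, −7}`** (the descent on the divisors of `a² − 4b = −28`, i.e. `S^{(φ)}(E₂/ℚ)`):
the classes `−1, −2, 7, 14` die `7`-adically (`7 ∣ a`, `7 ∥` the complementary divisor, non-residue
`−1, −2, −4, −2`), the class `2` dies `2`-adically (residues mod `2⁶`) and `−14 = 2 · (−7)` with it;
`1` and `−7 ≡ −28` are the images of `O` and `T'`. [cite: SilvermanAEC2009, Prop. X.4.9 and Example X.4.10] -/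
theorem mem_twoIsogenySelmerGroup_neg28 {d : ℤ} (h : d ∈ twoIsogenySelmerGroup (-84) (-28)) :
    d = 1 ∨ d = -7 := by
  haveI : Fact (Nat.Prime 2) := ⟨Nat.prime_two⟩
  haveI : Fact (Nat.Prime 7) := ⟨by norm_num⟩
  obtain ⟨hn1, hn2, hn4⟩ := not_isSquare_zmod_seven
  obtain ⟨hsq, hdvd, hloc⟩ := (mem_twoIsogenySelmerGroup_iff (by norm_num : (-28 : ℤ) ≠ 0)).mp h
  have habs := natAbs_eq_of_squarefree_of_dvd_neg28 hsq hdvd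
  rcases Int.natAbs_eq d with hpos | hneg
  · rcases habs with h1 | h2 | h7 | h14
    · left; omega
    · exfalso
      have hd2 : d = 2 := by omega
      subst hd2
      have h2' := hloc.2 2
      rw [show (-28 : ℤ) / 2 = -14 by norm_num] at h2'
      exact not_isSoluble_two_of_zmodPow 6 6 zmod_key_two_neg28.1 zmod_key_two_neg28.2 h2'
    · exfalso
      have hd7 : d = 7 := by omega
      subst hd7
      have h7' := hloc.2 7
      rw [show (-28 : ℤ) / 7 = -4 by norm_num, isSoluble_map_twoIsogenyQuartic_comm] at h7'
      exact not_isSoluble_padic_of_nonresidue_of_prime_dvd (p := 7) (c := -12) (e' := 1)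
        (by norm_num) (by norm_num) (by norm_num) hn4 h7'
    · exfalso
      have hd14 : d = 14 := by omega
      subst hd14
      have h7' := hloc.2 7
      rw [show (-28 : ℤ) / 14 = -2 by norm_num, isSoluble_map_twoIsogenyQuartic_comm] at h7'
      exact not_isSoluble_padic_of_nonresidue_of_prime_dvd (p := 7) (c := -12) (e' := 2)
        (by norm_num) (by norm_num) (by norm_num) hn2 h7'
  · rcases habs with h1 | h2 | h7 | h14
    · exfalso
      have hd1 : d = -1 := by omega
      subst hd1
      have h7' := hloc.2 7
      rw [show (-28 : ℤ) / -1 = 28 by norm_num] at h7'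
      exact not_isSoluble_padic_of_nonresidue_of_prime_dvd (p := 7) (c := -12) (e' := 4)
        (by norm_num) (by norm_num) (by norm_num) hn1 h7'
    · exfalso
      have hd2 : d = -2 := by omega
      subst hd2
      have h7' := hloc.2 7
      rw [show (-28 : ℤ) / -2 = 14 by norm_num] at h7'
      exact not_isSoluble_padic_of_nonresidue_of_prime_dvd (p := 7) (c := -12) (e' := 2)
        (by norm_num) (by norm_num) (by norm_num) hn2 h7'
    · right; omega
    · exfalso
      have hd14 : d = -14 := by omega
      subst hd14
      have h2' := hloc.2 2
      rw [show (-28 : ℤ) / -14 = 2 by norm_num, isSoluble_map_twoIsogenyQuartic_comm] at h2'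
      exact not_isSoluble_two_of_zmodPow 6 6 zmod_key_two_neg28.1 zmod_key_two_neg28.2 h2'

/-- `#S(42, 448) ≤ 2`. [cite: SilvermanAEC2009, Prop. X.4.9] -/
theorem card_twoIsogenySelmerGroup_448_le : (twoIsogenySelmerGroup 42 448).card ≤ 2 :=
  le_trans (Finset.card_le_card fun d hd => by
    have := mem_twoIsogenySelmerGroup_448 hd
    simp only [Finset.mem_insert, Finset.mem_singleton]
    exact this) (Finset.card_le_two (a := (1 : ℤ)) (b := 7))

/-- `#S'(42, 448) = #S(−84, −28) ≤ 2`. [cite: SilvermanAEC2009, Prop. X.4.9] -/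
theorem card_twoIsogenySelmerGroup'_448_le : (twoIsogenySelmerGroup' 42 448).card ≤ 2 := by
  rw [twoIsogenySelmerGroup'_eq, show (-2 * 42 : ℤ) = -84 by norm_num,
    show ((42 : ℤ) ^ 2 - 4 * 448) = -28 by norm_num]
  exact le_trans (Finset.card_le_card fun d hd => by
    have := mem_twoIsogenySelmerGroup_neg28 hd
    simp only [Finset.mem_insert, Finset.mem_singleton]
    exact this) (Finset.card_le_two (a := (1 : ℤ)) (b := -7))

end Selmer
/-! ## §3 Rank `0`, `Ш[2] = 0`, and the bsd.S31 hook for `49a1^{(2)}` -/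

section RankZero

/-- Arithmetic core: `k = 2^{r+2} (n₁ n₂) ≤ 4`, `k > 0` ⇒ `r = 0` and `n₁ = n₂ = 1`. [folklore] -/
private theorem rank_zero_arith {r n₁ n₂ k : ℕ} (hk : k = 2 ^ (r + 2) * (n₁ * n₂)) (hk4 : k ≤ 4)
    (hkpos : 0 < k) : r = 0 ∧ n₁ = 1 ∧ n₂ = 1 := by
  subst hk
  have hn₁ : 0 < n₁ := Nat.pos_of_ne_zero (by rintro rfl; simp at hkpos)
  have hn₂ : 0 < n₂ := Nat.pos_of_ne_zero (by rintro rfl; simp at hkpos)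
  have h2 : 2 ^ (r + 2) ≤ 4 := le_trans (Nat.le_mul_of_pos_right _ (Nat.mul_pos hn₁ hn₂)) hk4
  have hr : r = 0 := by
    by_contra hr
    have h8 : 2 ^ 3 ≤ 2 ^ (r + 2) := Nat.pow_le_pow_right (by norm_num) (by omega)
    omega
  subst hr
  norm_num at hk4
  refine ⟨rfl, ?_, ?_⟩ <;> nlinarith

/-- `b (a² − 4b) ≠ 0` for `(a, b) = (42, 448)`. [folklore] -/
theorem hab_twoTorsionModel_two : (448 : ℤ) * ((42 : ℤ) ^ 2 - 4 * 448) ≠ 0 := by norm_num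

/-- **`rank E₂(ℚ) = 0` and `Ш(E₂/ℚ)[2] = 0`** for `E₂ = [0, 42, 0, 448, 0]` (UNCONDITIONAL): the
descent count `#S · #S' = 2^{rank+2} · #Ш(E')[φ̂] · #Ш(E)[φ]` (tree `two_pow_twoIsogenySelmerRank_add_eq`,
Silverman X.4.2(a)) with `#S, #S' ≤ 2` forces `rank = 0` and both `φ`-parts of `Ш` trivial, whence
`Ш[2] = 0` (`forall_mem_sha_two_smul_eq_zero_of_halfModel`). This is the conductor-`3136` curve
`[0,0,0,−140,−784] = 49a1^{(2)}`, the FIXED rank-zero partner of family F3 (`d = −2q`, `q ≡ 3 (mod 4)`)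
of the genus mechanism. [cite: SilvermanAEC2009, Thm. X.4.2(a), Prop. X.4.9] -/
theorem rank_eq_zero_and_sha_two_twoTorsionModel_two :
    (⟨0, 42, 0, 448, 0⟩ : WeierstrassCurve ℚ).mordellWeilRank = 0 ∧
      ∀ c ∈ (⟨0, 42, 0, 448, 0⟩ : WeierstrassCurve ℚ).sha, 2 • c = 0 → c = 0 := by
  have hab := hab_twoTorsionModel_two
  haveI := isElliptic_halfModel hab
  haveI := isElliptic_mk_of_ne_zero (F := ℚ) hab
  have key := two_pow_twoIsogenySelmerRank_add_eq hab
  have h4 : 2 ^ (twoIsogenySelmerRank 42 448 + twoIsogenySelmerRank' 42 448) ≤ 4 := by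
    rw [pow_add, two_pow_twoIsogenySelmerRank_eq_card hab, two_pow_twoIsogenySelmerRank'_eq_card hab]
    exact Nat.mul_le_mul card_twoIsogenySelmerGroup_448_le card_twoIsogenySelmerGroup'_448_le
  obtain ⟨hr, h₁, h₂⟩ := rank_zero_arith key h4 (pow_pos two_pos _)
  have hsha := forall_mem_sha_two_smul_eq_zero_of_halfModel (AddSubgroup.eq_bot_of_card_eq _ h₁)
    (AddSubgroup.eq_bot_of_card_eq _ h₂)
  have e : (⟨0, ((42 : ℤ) : ℚ), 0, ((448 : ℤ) : ℚ), 0⟩ : WeierstrassCurve ℚ) = ⟨0, 42, 0, 448, 0⟩ := by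
    ext <;> push_cast <;> rfl
  refine ⟨?_, forall_mem_sha_two_congr e.symm hsha⟩
  rw [← mordellWeilRank_congr e]; exact hr

/-- **`rank cm7^{(2)}(ℚ) = 0` and `Ш(cm7^{(2)}/ℚ)[2] = 0`** (any model statement: transport along
`(1/2, 4, 0, 0) • cm7^{(2)} = [0, 42, 0, 448, 0]`). [cite: SilvermanAEC2009, Thm. X.4.2(a) and III.3.1(b)] -/
theorem rank_eq_zero_and_sha_two_cm7_quadraticTwist_two :
    (cm7.quadraticTwist 2).mordellWeilRank = 0 ∧
      ∀ c ∈ (cm7.quadraticTwist 2).sha, 2 • c = 0 → c = 0 := by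
  haveI := isElliptic_cm7_quadraticTwist_two
  obtain ⟨hr, hsha⟩ := rank_eq_zero_and_sha_two_twoTorsionModel_two
  set C : VariableChange ℚ := ⟨(Units.mk0 (2 : ℚ) two_ne_zero)⁻¹, 4, 0, 0⟩ with hC
  have hE : C • cm7.quadraticTwist 2 = ⟨0, 42, 0, 448, 0⟩ := twoTorsionChange_smul_cm7_quadraticTwist_two_rat
  refine ⟨?_, forall_mem_sha_two_of_smul _ C (forall_mem_sha_two_congr hE hsha)⟩
  have h := mordellWeilRank_variableChange_holds (cm7.quadraticTwist 2) C
  unfold mordellWeilRank_variableChange at h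
  rw [← hr, ← hE]
  convert h.symm using 2

/-- **Full BSD for the `3136⁺`-curve BY NAME** (bsd.S31: `[0, 42, 0, 448, 0]` is globally minimal,
`rank = 0 ≤ 1`, `N = 3136 < 5000`). [cite: CreutzMiller2012, Thm 1.1 and the remark following it]
[cite: Miller2011LMS, Thm 1.2] -/
theorem bsdTriple_twoTorsionModel_two (hS31 : bsdTriple_of_rank_le_one_of_conductor_lt)
    (hmod : exists_isNewformOf) : (⟨0, 42, 0, 448, 0⟩ : WeierstrassCurve ℚ).BSDTriple := by
  haveI : (⟨0, 42, 0, 448, 0⟩ : WeierstrassCurve ℚ).IsElliptic := by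
    haveI := isElliptic_cm7_quadraticTwist_two
    rw [← twoTorsionChange_smul_cm7_quadraticTwist_two_rat]; infer_instance
  haveI := isGloballyMinimal_twoTorsionModel_two
  exact hS31 _ (by rw [rank_eq_zero_and_sha_two_twoTorsionModel_two.1]; norm_num)
    (by rw [conductorNorm_twoTorsionModel_two hmod]; norm_num)

/-- **Consequences for `3136⁺`**: `r_an = 0` (so `L(E₂, 1) ≠ 0`), `Ш` finite of ODD order, and the
leading-term formula `L(E₂, 1) = Ω·#Ш·∏c_p / #tors²` — the fixed-curve input of family F3.
[cite: CreutzMiller2012, Thm 1.1 and the remark following it] -/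
theorem analyticRank_shaFinite_odd_twoTorsionModel_two
    (hS31 : bsdTriple_of_rank_le_one_of_conductor_lt) (hmod : exists_isNewformOf) :
    (⟨0, 42, 0, 448, 0⟩ : WeierstrassCurve ℚ).analyticRank = 0 ∧
      (⟨0, 42, 0, 448, 0⟩ : WeierstrassCurve ℚ).ShaFinite ∧
      Odd (⟨0, 42, 0, 448, 0⟩ : WeierstrassCurve ℚ).shaOrder ∧
      (⟨0, 42, 0, 448, 0⟩ : WeierstrassCurve ℚ).BSDLeadingTermFormula := by
  obtain ⟨hrank, hfin, hlead⟩ := bsdTriple_twoTorsionModel_two hS31 hmod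
  obtain ⟨hr0, hsha⟩ := rank_eq_zero_and_sha_two_twoTorsionModel_two
  refine ⟨hrank.trans hr0, hfin, ?_, hlead⟩
  haveI : Finite (⟨0, 42, 0, 448, 0⟩ : WeierstrassCurve ℚ).sha := hfin
  exact odd_natCard_of_forall_two_nsmul fun c hc ↦
    Subtype.ext (hsha c c.2 (by exact_mod_cast congrArg Subtype.val hc))

end RankZero
end Summit.BirchSwinnertonDyer.BirchSwinnertonDyer.Theorems.GoldfeldGoodTwists

end
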